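import Mathlib.LinearAlgebra.Matrix.Kronecker
import Mathlib.LinearAlgebra.Matrix.Notation
import Mathlib.Algebra.Lie.OfAssociative
import Literature.MathematicalPhysics.QuantumLattice.SpinOperators
import HarnessLib

/-!
# Two-site operators of the random loop representations of quantum spin systems (spin 1/2)

Reproduction of published work. D. Ueltschi, *Random loop representations for quantum spin
systems*, J. Math. Phys. **54**, 083301 (2013), arXiv:1301.0811, §2.1 (the operators `T`, `P`, `Q`
and the one-parameter families `H^{(u)} = -Σ (u T_{xy} + (1-u) Q_{xy} - 1)`,
`H̃^{(u)} = -Σ (u T_{xy} + (1-u) P_{xy} - 1)`), building on B. Tóth, Lett. Math. Phys. **28** (1993) 75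
(`T`: interchange / Heisenberg ferromagnet) and M. Aizenman, B. Nachtergaele, Comm. Math. Phys. **164**
(1994) 17 (`P`: Heisenberg antiferromagnet).

What is reproduced here, for spin `S = 1/2` and ONE pair of sites `{x, y}` (local space `ℂ² ⊗ ℂ²`,
Kronecker index `Fin 2 × Fin 2`, basis `k = 0 ↔ m = +1/2`, `k = 1 ↔ m = -1/2` as in
`SpinOperators`):

* the matrix elements `⟨a,b|T|c,d⟩ = δ_{ad} δ_{bc}`, `⟨a,b|P|c,d⟩ = (-1)^{a-c} δ_{a,-b} δ_{c,-d}`,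
  `⟨a,b|Q|c,d⟩ = δ_{ab} δ_{cd}` (Ueltschi 2013, eqs. (2.3)–(2.6));
* their expression through the Pauli matrices `σ = spinHalfPauli`:
  `T = ½(1 + σˣ⊗σˣ + σʸ⊗σʸ + σᶻ⊗σᶻ)` (Heisenberg exchange, Tóth),
  `P = ½(1 − σˣ⊗σˣ − σʸ⊗σʸ − σᶻ⊗σᶻ)` (twice the singlet projector, Aizenman–Nachtergaele),
  `Q = ½(1 + σˣ⊗σˣ − σʸ⊗σʸ + σᶻ⊗σᶻ)`;
* the `u`-family identity `u T + (1-u) Q = ½(1 + σˣ⊗σˣ + σᶻ⊗σᶻ) + (u − ½) σʸ⊗σʸ`, whose member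
  `u = ½` is the spin-1/2 quantum XY model IN THE x–z PLANE (`½T + ½Q = ½(1 + σˣ⊗σˣ + σᶻ⊗σᶻ)`), i.e.
  hard-core lattice bosons with the CONSERVED component along `y`;
* the symmetry facts behind that reading: `Q` (hence every `u T + (1-u) Q`) commutes with the total
  `y`-spin `σʸ⊗1 + 1⊗σʸ` and does NOT commute with the total `z`-spin `σᶻ⊗1 + 1⊗σᶻ`, while `T`
  commutes with `A⊗1 + 1⊗A` for every `A`; and Ueltschi's relation `Q_{xy} = e^{iπS²_y} P_{xy} e^{-iπS²_y}`
  in the matrix form `Q = (1 ⊗ W) P (1 ⊗ W⁻¹)` with `W = e^{-iπσʸ/2} = !![0,-1;1,0]`.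

Use (solo-informed seat, HubbardSuperconductivity, sharpest-statement v5 §5b(v)): in the `u = ½`
loop representation of hard-core bosons the particle number is the spin component along the
conserved axis `y`, transverse to the loop quantisation axis `z`, so a chemical potential has no
loop weight. All statements are finite `4 × 4` matrix identities over `ℂ`.
-/

noncomputable section

open Matrix Complex
open scoped Kronecker

namespace Literature.MathematicalPhysics.QuantumLattice

namespace Ueltschi2013

/-- Local two-site index for spin 1/2: `(a, b) ∈ Fin 2 × Fin 2` labels `|a⟩ ⊗ |b⟩` (Kronecker index). [folklore] -/
abbrev Idx : Type := Fin 2 × Fin 2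

/-- The transposition operator `T|a,b⟩ = |b,a⟩`: `⟨a,b|T|c,d⟩ = δ_{ad} δ_{bc}`.
Ueltschi (2013) §2.1, eq. (2.3); Tóth (1993). [cite: Ueltschi2013, arXiv:1301.0811 §2.1] -/
def loopT : Matrix Idx Idx ℂ :=
  fun p q => if p.1 = q.2 ∧ p.2 = q.1 then 1 else 0

/-- The operator `P`: `⟨a,b|P|c,d⟩ = (-1)^{a-c} δ_{a,-b} δ_{c,-d}`; `P/(2S+1)` is the singlet
projector. Ueltschi (2013) §2.1, eqs. (2.4)–(2.5); Aizenman–Nachtergaele (1994).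
[cite: Ueltschi2013, arXiv:1301.0811 §2.1] -/
def loopP : Matrix Idx Idx ℂ :=
  fun p q => if p.1 ≠ p.2 ∧ q.1 ≠ q.2 then (if p.1 = q.1 then 1 else -1) else 0

/-- The operator `Q`, "identical to `P` except for the signs": `⟨a,b|Q|c,d⟩ = δ_{ab} δ_{cd}`.
Ueltschi (2013) §2.1, eq. (2.6). [cite: Ueltschi2013, arXiv:1301.0811 §2.1] -/
def loopQ : Matrix Idx Idx ℂ :=
  fun p q => if p.1 = p.2 ∧ q.1 = q.2 then 1 else 0

/-- Two-site term of Ueltschi's family `H^{(u)}`: `u T + (1 - u) Q` (the constant `-1` and the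
overall sign of eq. (2.8) omitted). [cite: Ueltschi2013, arXiv:1301.0811 §2.1 eq. (2.8)] -/
def uFamily (u : ℂ) : Matrix Idx Idx ℂ :=
  u • loopT + (1 - u) • loopQ

/-- Shorthand: `σ^α ⊗ σ^α` on the pair (Kronecker product of `spinHalfPauli α` with itself). [folklore] -/
def pauliPair (α : Fin 3) : Matrix Idx Idx ℂ :=
  spinHalfPauli α ⊗ₖ spinHalfPauli α

/-- `T = ½(1 + σˣ⊗σˣ + σʸ⊗σʸ + σᶻ⊗σᶻ)` — the Heisenberg exchange (Dirac's identity).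
Tóth (1993); Ueltschi (2013) §2.1. [cite: Ueltschi2013, arXiv:1301.0811 §2.1] -/
theorem loopT_eq :
    loopT = (1 / 2 : ℂ) • (1 + pauliPair 0 + pauliPair 1 + pauliPair 2) := by
  ext ⟨a, b⟩ ⟨c, d⟩
  fin_cases a <;> fin_cases b <;> fin_cases c <;> fin_cases d <;>
    simp [loopT, pauliPair, spinHalfPauli, Matrix.kroneckerMap_apply,
      Matrix.add_apply, Matrix.smul_apply] <;> norm_num

/-- `P = ½(1 − σˣ⊗σˣ − σʸ⊗σʸ − σᶻ⊗σᶻ)` (twice the singlet projector `¼(1 − σ·σ)`).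
Aizenman–Nachtergaele (1994); Ueltschi (2013) §2.1. [cite: Ueltschi2013, arXiv:1301.0811 §2.1] -/
theorem loopP_eq :
    loopP = (1 / 2 : ℂ) • (1 - pauliPair 0 - pauliPair 1 - pauliPair 2) := by
  ext ⟨a, b⟩ ⟨c, d⟩
  fin_cases a <;> fin_cases b <;> fin_cases c <;> fin_cases d <;>
    simp [loopP, pauliPair, spinHalfPauli, Matrix.kroneckerMap_apply,
      Matrix.sub_apply, Matrix.smul_apply] <;> norm_num

/-- `Q = ½(1 + σˣ⊗σˣ − σʸ⊗σʸ + σᶻ⊗σᶻ)`. Ueltschi (2013) §2.1. [cite: Ueltschi2013, arXiv:1301.0811 §2.1] -/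
theorem loopQ_eq :
    loopQ = (1 / 2 : ℂ) • (1 + pauliPair 0 - pauliPair 1 + pauliPair 2) := by
  ext ⟨a, b⟩ ⟨c, d⟩
  fin_cases a <;> fin_cases b <;> fin_cases c <;> fin_cases d <;>
    simp [loopQ, pauliPair, spinHalfPauli, Matrix.kroneckerMap_apply,
      Matrix.add_apply, Matrix.sub_apply, Matrix.smul_apply] <;> norm_num

/-- The `u`-family through Pauli matrices:
`u T + (1-u) Q = ½(1 + σˣ⊗σˣ + σᶻ⊗σᶻ) + (u − ½) σʸ⊗σʸ`. At `u = 1` this is the Heisenberg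
ferromagnet's exchange, at `u = ½` the quantum XY model in the `x`–`z` plane, at `u = 0` the operator
`Q`. Ueltschi (2013) §2.1 (discussion after eq. (2.9)). [cite: Ueltschi2013, arXiv:1301.0811 §2.1] -/
theorem uFamily_eq (u : ℂ) :
    uFamily u = (1 / 2 : ℂ) • (1 + pauliPair 0 + pauliPair 2) + (u - 1 / 2) • pauliPair 1 := by
  rw [uFamily, loopT_eq, loopQ_eq]
  ext p q
  simp only [Matrix.add_apply, Matrix.sub_apply, Matrix.smul_apply, smul_eq_mul]
  ring

/-- The `u = ½` member is the spin-1/2 quantum XY model in the `x`–`z` plane: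
`½ T + ½ Q = ½ (1 + σˣ⊗σˣ + σᶻ⊗σᶻ) = ½ + 2 (SˣSˣ + SᶻSᶻ)`. Ueltschi (2013) §2.1.
[cite: Ueltschi2013, arXiv:1301.0811 §2.1] -/
theorem uFamily_half :
    uFamily (1 / 2) = (1 / 2 : ℂ) • (1 + pauliPair 0 + pauliPair 2) := by
  rw [uFamily_eq]
  simp

/-- Total spin component `α` of the pair, in Pauli units: `σ^α ⊗ 1 + 1 ⊗ σ^α`. [folklore] -/
def totalPauli (α : Fin 3) : Matrix Idx Idx ℂ :=
  spinHalfPauli α ⊗ₖ (1 : Matrix (Fin 2) (Fin 2) ℂ) + (1 : Matrix (Fin 2) (Fin 2) ℂ) ⊗ₖ spinHalfPauli α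

/-- `T` is `SU(2)`-invariant: it commutes with every total spin component (indeed with every
`A ⊗ 1 + 1 ⊗ A`). Ueltschi (2013) §2.1, Lemma 2.1 (a). [cite: Ueltschi2013, arXiv:1301.0811 Lemma 2.1] -/
theorem totalPauli_commute_loopT (α : Fin 3) : ⁅totalPauli α, loopT⁆ = 0 := by
  rw [Ring.lie_def, sub_eq_zero]
  fin_cases α <;>
  · ext ⟨a, b⟩ ⟨c, d⟩
    fin_cases a <;> fin_cases b <;> fin_cases c <;> fin_cases d <;>
      simp [totalPauli, loopT, spinHalfPauli, Matrix.kroneckerMap_apply, Matrix.one_apply,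
        Matrix.mul_apply, Matrix.add_apply, Fintype.sum_prod_type, Fin.sum_univ_two]

/-- `Q` conserves the total `y`-spin: `[σʸ⊗1 + 1⊗σʸ, Q] = 0` (so every `u T + (1-u) Q` has the
`U(1)` symmetry about the `y` axis; for `u = ½` this is particle-number conservation of the hard-core
bosons). Ueltschi (2013) §2.1, Lemma 2.1 (c) with `a⃗ ∥ e_y`. [cite: Ueltschi2013, arXiv:1301.0811 Lemma 2.1] -/
theorem totalPauliY_commute_loopQ : ⁅totalPauli 1, loopQ⁆ = 0 := by
  rw [Ring.lie_def, sub_eq_zero]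
  ext ⟨a, b⟩ ⟨c, d⟩
  fin_cases a <;> fin_cases b <;> fin_cases c <;> fin_cases d <;>
    simp [totalPauli, loopQ, spinHalfPauli, Matrix.kroneckerMap_apply, Matrix.one_apply,
      Matrix.mul_apply, Matrix.add_apply, Fintype.sum_prod_type, Fin.sum_univ_two]

/-- `Q` does NOT conserve the total `z`-spin (the loop quantisation axis): `[σᶻ⊗1 + 1⊗σᶻ, Q] ≠ 0`
(`Q` contains `σ⁺σ⁺ + σ⁻σ⁻`). Consequence used in the text: in the `u = ½` representation of hard-core
bosons the conserved charge lies along `y`, transverse to the axis in which the loops are drawn.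
[cite: Ueltschi2013, arXiv:1301.0811 §2.1] -/
theorem totalPauliZ_not_commute_loopQ : ⁅totalPauli 2, loopQ⁆ ≠ 0 := by
  intro h
  rw [Ring.lie_def, sub_eq_zero] at h
  have h' := congrFun (congrFun h ((0 : Fin 2), (0 : Fin 2))) ((1 : Fin 2), (1 : Fin 2))
  simp [totalPauli, loopQ, spinHalfPauli, Matrix.kroneckerMap_apply, Matrix.one_apply,
    Matrix.mul_apply, Matrix.add_apply, Fintype.sum_prod_type, Fin.sum_univ_two] at h'
  norm_num at h'

/-- The every-`u` conservation law: `[σʸ⊗1 + 1⊗σʸ, u T + (1-u) Q] = 0`.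
[cite: Ueltschi2013, arXiv:1301.0811 §2.1] -/
theorem totalPauliY_commute_uFamily (u : ℂ) : ⁅totalPauli 1, uFamily u⁆ = 0 := by
  have hT := totalPauli_commute_loopT 1
  have hQ := totalPauliY_commute_loopQ
  rw [Ring.lie_def, sub_eq_zero] at hT hQ ⊢
  simp only [uFamily, Matrix.mul_add, Matrix.add_mul, Matrix.mul_smul, Matrix.smul_mul, hT, hQ]

/-- The spin-1/2 rotation by `π` about the `y` axis, `W = e^{-iπσʸ/2} = -iσʸ = !![0,-1;1,0]`
(the one-site unitary of Ueltschi (2013) eq. (2.7) for `S = 1/2`). [folklore] -/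
def rotYPi : Matrix (Fin 2) (Fin 2) ℂ := !![0, -1; 1, 0]

/-- `W⁻¹ = Wᵀ = !![0,1;-1,0]`, the inverse rotation. [folklore] -/
def rotYPiInv : Matrix (Fin 2) (Fin 2) ℂ := !![0, 1; -1, 0]

/-- `W W⁻¹ = 1` (so `rotYPiInv` is the inverse of `rotYPi`). [folklore] -/
theorem rotYPi_mul_rotYPiInv : rotYPi * rotYPiInv = 1 := by
  ext i j
  fin_cases i <;> fin_cases j <;> simp [rotYPi, rotYPiInv, Matrix.mul_apply, Fin.sum_univ_two]

/-- Ueltschi's relation (c): `Q_{xy} = e^{iπS²_y} P_{xy} e^{-iπS²_y}` — conjugating ONE site by the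
`π`-rotation about `y` turns the antiferromagnetic operator `P` into `Q`; matrix form
`Q = (1 ⊗ W) P (1 ⊗ W⁻¹)`. Ueltschi (2013) §2.1, proof of Lemma 2.1, eq. (2.7).
[cite: Ueltschi2013, arXiv:1301.0811 eq. (2.7)] -/
theorem loopQ_eq_conj_loopP :
    loopQ = ((1 : Matrix (Fin 2) (Fin 2) ℂ) ⊗ₖ rotYPi) * loopP * ((1 : Matrix (Fin 2) (Fin 2) ℂ) ⊗ₖ rotYPiInv) := by
  ext ⟨a, b⟩ ⟨c, d⟩
  fin_cases a <;> fin_cases b <;> fin_cases c <;> fin_cases d <;>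
    simp [loopQ, loopP, rotYPi, rotYPiInv, Matrix.kroneckerMap_apply, Matrix.one_apply,
      Matrix.mul_apply, Fintype.sum_prod_type, Fin.sum_univ_two]

end Ueltschi2013

end Literature.MathematicalPhysics.QuantumLattice

end
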